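import Literature.MathematicalPhysics.QuantumManyBody.CubicTrialVectorCubicTerms
import Literature.MathematicalPhysics.QuantumManyBody.CubicTrialVectorPairing
import HarnessLib

/-!
# Scalar quantities attached to the cubic trial vector: arrangement sums, cutoff defects,
# the norm, the cubic coefficient of `ℒ⁽³⁾` and the hard kernel of `G₁`

Topic `Literature/MathematicalPhysics/QuantumManyBody`, namespace `BoseGas.Fock`; definitions (with
bodies) naming the scalar expressions that the theorem-only files `CubicTrialVectorCubicTerms.lean`,
`CubicTrialVectorPairing.lean`, `BogoliubovCubicBlock.lean` spell out, for the provefact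
`Literature.MathematicalPhysics.QuantumManyBody.BoseGas.BastiCenatiempoSchlein2021_upperBound`
(§5 of [BastiCenatiempoSchlein2021]), together with the landed identities restated in this
vocabulary:

* `arrSum f τ = ∑_{orderings of (u,a,b)} f` — the symmetrised coefficient `f̃_τ` of a cubic sum;
* `cutoffDefect κ τ = ∑_{θ(S), τ∈S ∨ ¬θ(S∪τ)} |c_S|²` (`D_τ`, the cutoff error of (5.9)–(5.10)) and
  `pairCutoffDefect κ τ' τ` (the two-triple version of (5.13)–(5.14));
* `cubicNormSq κ = ∑_S |c_S|² = ‖ξ_ν‖²` and `ampNormSq κ = ∑_τ |κ_τ|²`;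
* `cubicCoeff e W γ σ i j k` — the coefficient of `⟨ξ, a†_ia†_ja†_kξ⟩` in `Re ℒ⁽³⁾`
  (`BogoliubovCubicBlock.L3_block_eq`, the `a†a†a†`-coefficient plus the conjugate of the
  `aaa`-coefficient, on zero-momentum triples);
* `hardKernel e W γ P_H x y x' y' = [x,y,x',y' ∈ P_H] c(x,y,x',y') γ_yγ_xγ_{y'}γ_{x'}` — the kernel of
  the hard pair-annihilation block `𝒱_N^{(H)}`.

Restatements: `sum_mul_cubicExp_eq_freed'`, `norm_sum_mul_cutoffDefect_le`,
`quartic_pairing_decomposition'`, `pairCutoffDefect_le`, `cubicNormSq_eq`.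

## References

* [BastiCenatiempoSchlein2021] G. Basti, S. Cenatiempo, B. Schlein, Forum Math. Sigma 9 (2021) e74,
  arXiv:2101.06222: §4 (`𝒞_N`, `F₁`–`F₃`, `𝒱_N^{(H)}`), §5.2 (5.8)–(5.10), §5.3 (5.12)–(5.14).
-/

noncomputable section

namespace Literature.MathematicalPhysics.QuantumManyBody.BoseGas

open Complex MvPolynomial Finset
open scoped ComplexConjugate BigOperators

namespace Fock

variable {ι : Type*} [DecidableEq ι] [LinearOrder ι] {e : ι → Momentum} {PH PS : Finset ι}

/-! ### Definitions -/

section Defs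

/-- **The arrangement sum** `f̃_τ = f(u,a,b) + f(a,u,b) + f(u,b,a) + f(a,b,u) + f(b,u,a) + f(b,a,u)`:
the coefficient with which a triple `τ = (u,a,b)` enters `∑_{i,j,k} f(i,j,k)⟨ξ_ν, a†_ia†_ja†_kξ_ν⟩`.
[cite: BastiCenatiempoSchlein2021, §5.2 (5.8)] -/
def arrSum (f : ι → ι → ι → ℂ) (τ : Triple e PH PS) : ℂ :=
  f τ.u τ.a τ.b + f τ.a τ.u τ.b + f τ.u τ.b τ.a + f τ.a τ.b τ.u + f τ.b τ.u τ.a + f τ.b τ.a τ.u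

variable [Fintype ι]

/-- **The cutoff defect** `D_τ = ∑_{θ(S), τ ∈ S ∨ ¬θ(S ∪ τ)} |c_S|²`: the weight of the admissible
sets with which the triple `τ` is incompatible (the error made in "freeing" the creation of `τ`).
[cite: BastiCenatiempoSchlein2021, §5.2 (5.9)–(5.10)] -/
def cutoffDefect (κ : Triple e PH PS → ℂ) (τ : Triple e PH PS) : ℝ :=
  ∑ S : Finset (Triple e PH PS),
    (if TripleAdm e S ∧ (τ ∈ S ∨ ¬ TripleAdm e (insert τ S)) then ‖setCoeff κ (TripleAdm e) S‖ ^ 2 else 0)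

/-- **The pair cutoff defect** of two triples `τ', τ`: the weight of the sets `R` for which not both
`R ∪ τ'` and `R ∪ τ` are admissible extensions. [cite: BastiCenatiempoSchlein2021, §5.3 (5.13)–(5.14)] -/
def pairCutoffDefect (κ : Triple e PH PS → ℂ) (τ' τ : Triple e PH PS) : ℝ :=
  ∑ R : Finset (Triple e PH PS),
    (if ¬ (τ' ∉ R ∧ τ ∉ R ∧ TripleAdm e (insert τ' R) ∧ TripleAdm e (insert τ R)) then
      ‖setCoeff κ (TripleAdm e) R‖ ^ 2 else 0)

/-- **`‖ξ_ν‖² = ∑_{θ(S)} |c_S|²`** as a scalar. [cite: BastiCenatiempoSchlein2021, (2.16)] -/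
def cubicNormSq (κ : Triple e PH PS → ℂ) : ℝ :=
  ∑ S : Finset (Triple e PH PS), ‖setCoeff κ (TripleAdm e) S‖ ^ 2

/-- **`∑_τ |κ_τ|²`** (the quantity `N^{-1}∑(η_r+η_{r+v})²σ_v² ≤ C N^{δ}` controlling all moments of
`ξ_ν`). [cite: BastiCenatiempoSchlein2021, Prop. 2.3] -/
def ampNormSq (κ : Triple e PH PS → ℂ) : ℝ := ∑ τ : Triple e PH PS, ‖κ τ‖ ^ 2

omit [Fintype ι] in
/-- **The coefficient of `⟨ξ, a†_ia†_ja†_kξ⟩` in `Re ℒ⁽³⁾`** on a zero-momentum triple: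
`[(W(-e k)+W(e j))γ_iσ_jσ_k + (W(-e i)+W(e j))γ_iγ_jσ_k] + conj[(W(e k)+W(-e j))γ_iσ_jσ_k + (W(e i)+W(-e j))γ_iγ_jσ_k]`
(`BogoliubovCubicBlock.L3_block_eq`: the `aaa`-words contribute the conjugate).
[cite: BastiCenatiempoSchlein2021, §4 (`𝒞_N + F₁ + F₂ + F₃`)] -/
def cubicCoeff (e : ι → Momentum) (W : Momentum → ℂ) (gm sg : ι → ℝ) (i j k : ι) : ℂ :=
  if e i + e j + e k = 0 then
    ((W (-e k) + W (e j)) * ((gm i * sg j * sg k : ℝ) : ℂ) + (W (-e i) + W (e j)) * ((gm i * gm j * sg k : ℝ) : ℂ)) +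
      conj ((W (e k) + W (-e j)) * ((gm i * sg j * sg k : ℝ) : ℂ) + (W (e i) + W (-e j)) * ((gm i * gm j * sg k : ℝ) : ℂ))
  else 0

omit [Fintype ι] [LinearOrder ι] in
/-- **The kernel of the hard pair-annihilation block**:
`[x,y,x',y' ∈ P_H]·[e x+e y = e x'+e y'] W(e x'-e x)·γ_yγ_xγ_{y'}γ_{x'}`.
[cite: BastiCenatiempoSchlein2021, §4 (`𝒱_N^{(H)}`), Prop. 3.1] -/
def hardKernel (e : ι → Momentum) (W : Momentum → ℂ) (gm : ι → ℝ) (PH : Finset ι) (x y x' y' : ι) : ℂ :=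
  if x ∈ PH ∧ y ∈ PH ∧ x' ∈ PH ∧ y' ∈ PH then
    pairCoeff' e W x y x' y' * ((gm y * gm x * (gm y' * gm x') : ℝ) : ℂ) else 0

end Defs

/-! ### API -/

section API

variable [Fintype ι]

/-- `‖ξ_ν‖² = cubicNormSq`. [cite: BastiCenatiempoSchlein2021, (2.16)] -/
theorem cubicNormSq_eq (hHS : Disjoint PH PS) (κ : Triple e PH PS → ℂ) :
    (fockInner (cubicVector e PH PS κ) (cubicVector e PH PS κ)).re = cubicNormSq κ :=
  fockInner_cubicVector_self_re hHS κ

/-- `0 ≤ D_τ ≤ ‖ξ_ν‖²`. [folklore] -/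
theorem cutoffDefect_nonneg_le (κ : Triple e PH PS → ℂ) (τ : Triple e PH PS) :
    0 ≤ cutoffDefect κ τ ∧ cutoffDefect κ τ ≤ cubicNormSq κ :=
  defect_nonneg_le κ τ

/-- `0 ≤ cubicNormSq`. [folklore] -/
theorem cubicNormSq_nonneg (κ : Triple e PH PS → ℂ) : 0 ≤ cubicNormSq κ :=
  Finset.sum_nonneg fun _ _ => sq_nonneg _

/-- `0 ≤ ampNormSq`. [folklore] -/
theorem ampNormSq_nonneg (κ : Triple e PH PS → ℂ) : 0 ≤ ampNormSq κ :=
  Finset.sum_nonneg fun _ _ => sq_nonneg _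

/-- The pair defect is non-negative and at most `D_{τ'} + D_τ`. [folklore] -/
theorem pairCutoffDefect_nonneg_le (κ : Triple e PH PS → ℂ) (τ' τ : Triple e PH PS) :
    0 ≤ pairCutoffDefect κ τ' τ ∧ pairCutoffDefect κ τ' τ ≤ cutoffDefect κ τ' + cutoffDefect κ τ :=
  ⟨(pairDefect_nonneg_le κ τ' τ).1, pairDefect_le κ τ' τ⟩

/-- **The cubic expectation, freed** (restated): `∑ f⟨ξ_ν, X_iX_jX_kξ_ν⟩ = (∑_τ f̃_τ conj κ_τ)‖ξ_ν‖² - ∑_τ f̃_τ conj(κ_τ) D_τ`.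
[cite: BastiCenatiempoSchlein2021, §5.2 (5.8)–(5.10)] -/
theorem sum_mul_cubicExp_eq_freed' (hHS : Disjoint PH PS) (κ : Triple e PH PS → ℂ) (f : ι → ι → ι → ℂ) :
    ∑ i, ∑ j, ∑ k, f i j k * fockInner (cubicVector e PH PS κ) (X i * (X j * (X k * cubicVector e PH PS κ))) =
      (∑ τ : Triple e PH PS, arrSum f τ * conj (κ τ)) * ((cubicNormSq κ : ℝ) : ℂ) -
        ∑ τ : Triple e PH PS, arrSum f τ * conj (κ τ) * ((cutoffDefect κ τ : ℝ) : ℂ) :=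
  sum_mul_cubicExp_eq_freed hHS κ f

/-- **The second moment with squares** (restated): `∑_S |c_S|²|S|² ≤ ((∑|κ|²)² + ∑|κ|²)‖ξ_ν‖²`.
[cite: BastiCenatiempoSchlein2021, Prop. 2.3] -/
theorem sum_normSq_setCoeff_mul_card_sq_le' (κ : Triple e PH PS → ℂ) :
    ∑ S : Finset (Triple e PH PS), ‖setCoeff κ (TripleAdm e) S‖ ^ 2 * (S.card : ℝ) ^ 2 ≤
      (ampNormSq κ ^ 2 + ampNormSq κ) * cubicNormSq κ :=
  sum_normSq_setCoeff_mul_card_sq_le κ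

/-- **The coincidence bound for weighted cutoff defects** (restated, with a sup-weight): if
`g ≤ G·|κ|` pointwise and `F₁, F₂` bound the two- and three-index coincidence sums of `|κ|`,
then `∑_τ g_τ D_τ ≤ G(F₁K₁ + F₂K₁²)‖ξ_ν‖²`, `K₁ = ∑|κ|²`.
[cite: BastiCenatiempoSchlein2021, §5.2 (5.15)–(5.17)] -/
theorem sum_mul_cutoffDefect_le (he : Function.Injective e) (κ : Triple e PH PS → ℂ)
    (g : Triple e PH PS → ℝ) {G : ℝ} (hG : 0 ≤ G) (hgle : ∀ τ, g τ ≤ G * ‖κ τ‖)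
    {F₁ F₂ : ℝ} (hF₁ : 0 ≤ F₁) (hF₂ : 0 ≤ F₂)
    (hF₁le : ∀ τ' : Triple e PH PS, ∑ τ : Triple e PH PS,
      (if τ.b = τ'.b ∨ (∃ p, (p = τ.u ∨ p = τ.a) ∧ (p = τ'.u ∨ p = τ'.a)) ∨
          (∃ p, (p = τ.u ∨ p = τ.a) ∧ e p + e p + e τ'.b = 0) ∨ (∃ p', (p' = τ'.u ∨ p' = τ'.a) ∧ e p' + e p' + e τ.b = 0)
        then ‖κ τ‖ else 0) ≤ F₁)
    (hF₂le : ∀ τj τk : Triple e PH PS, τj ≠ τk → ∑ τ : Triple e PH PS,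
      (if (∃ pj pk, (pj = τj.u ∨ pj = τj.a) ∧ (pk = τk.u ∨ pk = τk.a) ∧ e pj + e pk + e τ.b = 0) ∨
          (∃ p pk, (p = τ.u ∨ p = τ.a) ∧ (pk = τk.u ∨ pk = τk.a) ∧ e p + e pk + e τj.b = 0)
        then ‖κ τ‖ else 0) ≤ F₂) :
    ∑ τ : Triple e PH PS, g τ * cutoffDefect κ τ ≤
      G * (F₁ * ampNormSq κ + F₂ * ampNormSq κ ^ 2) * cubicNormSq κ := by
  -- compare with the weight `G|κ|` and apply `sum_mul_defect_le`
  have hD0 : ∀ τ, 0 ≤ cutoffDefect κ τ := fun τ => (cutoffDefect_nonneg_le κ τ).1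
  calc ∑ τ : Triple e PH PS, g τ * cutoffDefect κ τ ≤ ∑ τ : Triple e PH PS, (G * ‖κ τ‖) * cutoffDefect κ τ :=
        Finset.sum_le_sum fun τ _ => mul_le_mul_of_nonneg_right (hgle τ) (hD0 τ)
    _ ≤ (G * F₁ * ampNormSq κ + G * F₂ * ampNormSq κ ^ 2) * cubicNormSq κ := by
        have h := sum_mul_defect_le he κ (fun τ => G * ‖κ τ‖) (fun τ => by positivity) (mul_nonneg hG hF₁)
          (mul_nonneg hG hF₂) (fun τ' => ?_) (fun τj τk hjk => ?_)
        · exact h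
        · rw [show (G * F₁ : ℝ) = G * F₁ from rfl]
          calc _ = G * ∑ τ : Triple e PH PS, (if τ.b = τ'.b ∨ (∃ p, (p = τ.u ∨ p = τ.a) ∧ (p = τ'.u ∨ p = τ'.a)) ∨
                (∃ p, (p = τ.u ∨ p = τ.a) ∧ e p + e p + e τ'.b = 0) ∨
                (∃ p', (p' = τ'.u ∨ p' = τ'.a) ∧ e p' + e p' + e τ.b = 0) then ‖κ τ‖ else 0) := by
                rw [Finset.mul_sum]
                refine Finset.sum_congr rfl fun τ _ => ?_
                split_ifs <;> simp
            _ ≤ G * F₁ := mul_le_mul_of_nonneg_left (hF₁le τ') hG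
        · calc _ = G * ∑ τ : Triple e PH PS, (if (∃ pj pk, (pj = τj.u ∨ pj = τj.a) ∧ (pk = τk.u ∨ pk = τk.a) ∧
                e pj + e pk + e τ.b = 0) ∨
                (∃ p pk, (p = τ.u ∨ p = τ.a) ∧ (pk = τk.u ∨ pk = τk.a) ∧ e p + e pk + e τj.b = 0) then ‖κ τ‖ else 0) := by
                rw [Finset.mul_sum]
                refine Finset.sum_congr rfl fun τ _ => ?_
                split_ifs <;> simp
            _ ≤ G * F₂ := mul_le_mul_of_nonneg_left (hF₂le τj τk hjk) hG
    _ = G * (F₁ * ampNormSq κ + F₂ * ampNormSq κ ^ 2) * cubicNormSq κ := by ring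

omit [Fintype ι] [LinearOrder ι] in
/-- `|hardKernel| ≤ W₀g₀⁴` when `|W| ≤ W₀` and `|γ| ≤ g₀` on `P_H`. [folklore] -/
theorem norm_hardKernel_le (W : Momentum → ℂ) {W₀ : ℝ} (hW : ∀ k, ‖W k‖ ≤ W₀) (gm : ι → ℝ)
    {g₀ : ℝ} (hg₀ : 0 ≤ g₀) (hgH : ∀ p ∈ PH, |gm p| ≤ g₀) (x y x' y' : ι) :
    ‖hardKernel e W gm PH x y x' y'‖ ≤ W₀ * g₀ ^ 4 := by
  have hW₀ : 0 ≤ W₀ := le_trans (norm_nonneg _) (hW 0)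
  unfold hardKernel
  split_ifs with h
  · rw [norm_mul, Complex.norm_real, Real.norm_eq_abs]
    refine mul_le_mul ?_ ?_ (abs_nonneg _) hW₀
    · unfold pairCoeff'
      split_ifs
      · exact hW _
      · rw [norm_zero]; exact hW₀
    · rw [abs_mul, abs_mul, abs_mul]
      calc |gm y| * |gm x| * (|gm y'| * |gm x'|) ≤ g₀ * g₀ * (g₀ * g₀) :=
            mul_le_mul (mul_le_mul (hgH _ h.2.1) (hgH _ h.1) (abs_nonneg _) hg₀)
              (mul_le_mul (hgH _ h.2.2.2) (hgH _ h.2.2.1) (abs_nonneg _) hg₀) (by positivity) (by positivity)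
        _ = g₀ ^ 4 := by ring
  · rw [norm_zero]; positivity

/-- **The hard pair-annihilation block of the cubic vector** (restated from
`quartic_pairing_decomposition` with the kernel `hardKernel`): its `P_H⁴`-sum equals
`∑_{τ',τ: b=b'} κ_{τ'} conj(κ_τ) K̃(τ,τ') (‖ξ_ν‖² - D₂(τ',τ)) + B`, `|B| ≤ 16W₀g₀⁴ ∑_S|c_S|²|S|²`.
[cite: BastiCenatiempoSchlein2021, §5.3 (5.12)–(5.14)] -/
theorem quartic_pairing_decomposition' (he : Function.Injective e) (hHS : Disjoint PH PS)
    (κ : Triple e PH PS → ℂ) (W : Momentum → ℂ) {W₀ : ℝ} (hW : ∀ k, ‖W k‖ ≤ W₀) (gm : ι → ℝ)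
    {g₀ : ℝ} (hg₀ : 0 ≤ g₀) (hgH : ∀ p ∈ PH, |gm p| ≤ g₀) :
    ∃ B : ℂ, ‖B‖ ≤ 16 * (W₀ * g₀ ^ 4) * ∑ S : Finset (Triple e PH PS), ‖setCoeff κ (TripleAdm e) S‖ ^ 2 * (S.card : ℝ) ^ 2 ∧
      ∑ x ∈ PH, ∑ y ∈ PH, ∑ x' ∈ PH, ∑ y' ∈ PH, pairCoeff' e W x y x' y' * ((gm y * gm x * (gm y' * gm x') : ℝ) : ℂ) *
          fockInner (pderiv y (pderiv x (cubicVector e PH PS κ))) (pderiv y' (pderiv x' (cubicVector e PH PS κ))) =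
        (∑ τ' : Triple e PH PS, ∑ τ : Triple e PH PS, (if τ.b = τ'.b then
          κ τ' * conj (κ τ) * (hardKernel e W gm PH τ.u τ.a τ'.u τ'.a + hardKernel e W gm PH τ.u τ.a τ'.a τ'.u +
              hardKernel e W gm PH τ.a τ.u τ'.u τ'.a + hardKernel e W gm PH τ.a τ.u τ'.a τ'.u) *
            (((cubicNormSq κ : ℝ) : ℂ) - ((pairCutoffDefect κ τ' τ : ℝ) : ℂ)) else 0)) + B := by
  have hW₀ : 0 ≤ W₀ := le_trans (norm_nonneg _) (hW 0)
  obtain ⟨B, hB, hdec⟩ := quartic_pairing_decomposition he hHS κ (hardKernel e W gm PH) (by positivity)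
    (norm_hardKernel_le W hW gm hg₀ hgH)
  refine ⟨B, hB, ?_⟩
  calc _ = ∑ x ∈ PH, ∑ y ∈ PH, ∑ x' ∈ PH, ∑ y' ∈ PH, hardKernel e W gm PH x y x' y' *
        fockInner (pderiv y (pderiv x (cubicVector e PH PS κ))) (pderiv y' (pderiv x' (cubicVector e PH PS κ))) := by
        refine Finset.sum_congr rfl fun x hx => Finset.sum_congr rfl fun y hy => Finset.sum_congr rfl fun x' hx' =>
          Finset.sum_congr rfl fun y' hy' => ?_
        unfold hardKernel
        rw [if_pos ⟨hx, hy, hx', hy'⟩]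
    _ = _ := hdec

end API

end Fock

end Literature.MathematicalPhysics.QuantumManyBody.BoseGas

end
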